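import Summits.Ventures.DiscreteObjects.Hadamard.ConferenceGraph333EvenAutomorphisms

/-!
# Cycle-type parity from twisted traces: every orbit length `> 1` occurs an even number of times (kernel tool)

Framing: lottery ticket; floor = certified bounds/negative ranges.  Cell pub-namedobj (venture DiscreteObjects),
target (H) = `H(668)`, hadamard gen 29.  The REPRESENTATION-THEORETIC form of the Galois refinement of the
automorphism census of `srg(333,166,82,83)` ⇔ symmetric `C(334)` (⇒ `H(668)`).  Setting (entrywise, any finite vertex
type `V`, `v = |V|`): a symmetric integer kernel `S` with zero row sums and `Σ_z S_xz S_zy = v[x=y] − 1` (a Seidel matrix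
with `S² = vI − J`, `S𝟙 = 0`), a permutation `τ` with `τ^n = 1` preserving `S`, and the TWISTED TRACES
`Σ_x S_{x,τ^k x} = 0` for all `k` (for the srg and `37 ∤ n` these vanish: `ConferenceGraph333OddFixedPoints`).  Then over
`ℂ` the permutation matrix `P` of `τ` preserves the `√v`-eigenspace `E₊` of `S`, and for a primitive `d`-th root of
unity `w` (`d ∣ n`, `d > 1`) the product of the commuting idempotents `q = n⁻¹ Σ_k w^k P^k` and `π₊ = (S² + √v S)/(2v)`
is an idempotent whose trace — a natural number `r` (Mathlib `LinearMap.IsProj.trace`) — equals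
`(2n)⁻¹ Σ_k w^k (#Fix τ^k − 1) = (2n)⁻¹ Σ_k w^k #Fix τ^k = N_d / 2`, where `N_d` is the number of `⟨τ⟩`-orbits whose length
is divisible by `d` (orbit-by-orbit geometric sums).  Hence:
* **`even_card_orbits_of_twisted_traces`** — `N_d` is EVEN for every `d > 1`; equivalently (Möbius over the divisors
  of `n`) every orbit length `L > 1` occurs an even number of times in the cycle type of `τ`.
* helpers: `trace_natCast_of_idempotent` (an idempotent complex matrix has trace in `ℕ`), `geom_sum_of_pow_eq_one`,
  `filter_dvd_range_eq_image`, `sum_indicator_dvd_pow`.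
This sharpens all parity laws of gen 28 (`p`-orbits: `m` even; involutions `f ≡ 1 (4)`; order `4`:
`#Fix τ² ≡ 2#Fix τ + 3 (8)`) when `37 ∤ n`.  Ours; elementary linear algebra over `ℂ` (no Galois theory: the arithmetic
input is entirely in the vanishing of the twisted traces).  No `sorry`, no new definitions.
-/

namespace Summit.Ventures.DiscreteObjects.Hadamard

open Finset

section helpers
variable {V : Type*} [Fintype V] [DecidableEq V]

/-- An idempotent complex matrix has a natural number (its rank) as trace. -/
theorem trace_natCast_of_idempotent (E : Matrix V V ℂ) (hE : E * E = E) : ∃ r : ℕ, E.trace = r := by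
  have h1 : IsIdempotentElem (Matrix.toLin' E) := by
    rw [IsIdempotentElem, Module.End.mul_eq_comp, ← Matrix.toLin'_mul, hE]
  refine ⟨Module.finrank ℂ (LinearMap.range (Matrix.toLin' E)), ?_⟩
  rw [← Matrix.trace_toLin'_eq, (LinearMap.IsIdempotentElem.isProj_range _ h1).trace]

omit [Fintype V] [DecidableEq V] in
/-- Geometric sum of a root of unity. -/
theorem geom_sum_of_pow_eq_one {w : ℂ} {m : ℕ} (hw : w ^ m = 1) :
    ∑ j ∈ range m, w ^ j = if w = 1 then (m : ℂ) else 0 := by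
  split_ifs with h
  · simp [h]
  · rw [geom_sum_eq h, hw, sub_self, zero_div]

omit [Fintype V] [DecidableEq V] in
/-- The multiples of `L` below `n` (`0 < L`, `L ∣ n`). -/
theorem filter_dvd_range_eq_image {L n : ℕ} (hL : 0 < L) (hLn : L ∣ n) :
    (range n).filter (fun k => L ∣ k) = (range (n / L)).image (fun j => L * j) := by
  obtain ⟨m, rfl⟩ := hLn
  rw [Nat.mul_div_cancel_left m hL]
  ext k
  simp only [mem_filter, mem_range, mem_image]
  constructor
  · rintro ⟨hk, j, rfl⟩
    exact ⟨j, (Nat.mul_lt_mul_left hL).mp hk, rfl⟩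
  · rintro ⟨j, hj, rfl⟩
    exact ⟨(Nat.mul_lt_mul_left hL).mpr hj, j, rfl⟩

omit [Fintype V] [DecidableEq V] in
/-- `Σ_{k<n, L ∣ k} w^k = n/L` if `w^L = 1` and `0` otherwise (`w^n = 1`, `L ∣ n`, `0 < L`). -/
theorem sum_indicator_dvd_pow {w : ℂ} {n L : ℕ} (hL : 0 < L) (hLn : L ∣ n) (hw : w ^ n = 1) :
    ∑ k ∈ range n, (if L ∣ k then w ^ k else 0) = if w ^ L = 1 then ((n / L : ℕ) : ℂ) else 0 := by
  rw [← Finset.sum_filter, filter_dvd_range_eq_image hL hLn, Finset.sum_image]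
  · simp_rw [pow_mul]
    apply geom_sum_of_pow_eq_one
    rw [← pow_mul, Nat.mul_div_cancel' hLn, hw]
  · intro j _ k _ h
    exact Nat.eq_of_mul_eq_mul_left hL h

end helpers

section main
variable {V : Type*} [Fintype V] [DecidableEq V]

/-- **Cycle-type parity from twisted traces.**  `S` a symmetric integer kernel on `V` with zero row sums and
`Σ_z S_xz S_zy = |V|[x=y] − 1`; `τ` a permutation with `τ^n = 1` (`n > 0`) preserving `S`; all twisted traces
`Σ_x S_{x,τ^k x}` vanish.  Then for every `d > 1` the number of `⟨τ⟩`-orbits (same-cycle classes) whose size is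
divisible by `d` is EVEN. -/
theorem even_card_orbits_of_twisted_traces (τ : Equiv.Perm V) {n : ℕ} (hn : 0 < n) (hτ : τ ^ n = 1)
    (S : V → V → ℤ) (hSτ : ∀ x y, S (τ x) (τ y) = S x y) (hSs : ∀ x y, S y x = S x y)
    (hS1 : ∀ x, ∑ y, S x y = 0)
    (hSS : ∀ x y, ∑ z, S x z * S z y = (Fintype.card V : ℤ) * (if x = y then 1 else 0) - 1)
    (htw : ∀ k : ℕ, ∑ x, S x ((τ ^ k) x) = 0) {d : ℕ} (hd : 1 < d) :
    Even (((univ : Finset V).image fun x => univ.filter fun y => τ.SameCycle x y).filter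
      fun O => d ∣ O.card).card := by
  -- orbits and periods
  set L : V → ℕ := fun x => Function.minimalPeriod τ x with hL_def
  set orb : V → Finset V := fun x => univ.filter fun y => τ.SameCycle x y with horb_def
  set N : ℕ := (((univ : Finset V).image orb).filter fun O => d ∣ O.card).card with hN_def
  have hLpos : ∀ x, 0 < L x := fun x => perm_minimalPeriod_pos τ x
  have hLdvd : ∀ x, L x ∣ n := fun x => by
    refine Function.IsPeriodicPt.minimalPeriod_dvd ?_
    show (τ : V → V)^[n] x = x
    rw [Equiv.Perm.iterate_eq_pow, hτ, Equiv.Perm.one_apply]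
  have hcard : ∀ x, (orb x).card = L x := fun x => by
    simp only [horb_def]
    rw [sameCycle_filter_eq_image τ x, Finset.card_image_of_injOn (perm_pow_injOn_range τ x), Finset.card_range]
  have horb_mem : ∀ x y, y ∈ orb x → orb y = orb x := by
    intro x y h
    simp only [horb_def, Finset.mem_filter, Finset.mem_univ, true_and] at h
    ext z
    simp only [horb_def, Finset.mem_filter, Finset.mem_univ, true_and]
    exact ⟨fun hz => h.trans hz, fun hz => h.symm.trans hz⟩
  have horb_self : ∀ x, x ∈ orb x := fun x => by simp [horb_def, Equiv.Perm.SameCycle.refl]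
  have hfix_iff : ∀ (k : ℕ) (x : V), (τ ^ k) x = x ↔ L x ∣ k := by
    intro k x
    rw [← Equiv.Perm.iterate_eq_pow]
    exact Function.isPeriodicPt_iff_minimalPeriod_dvd
  -- trivial case: d ∤ n
  by_cases hdn : d ∣ n
  swap
  · have : ((univ : Finset V).image orb).filter (fun O => d ∣ O.card) = ∅ := by
      rw [Finset.filter_eq_empty_iff]
      intro O hO hdO
      rw [Finset.mem_image] at hO
      obtain ⟨x, -, rfl⟩ := hO
      rw [hcard] at hdO
      exact hdn (hdO.trans (hLdvd x))
    rw [hN_def, this]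
    simp
  -- trivial case: V empty
  rcases isEmpty_or_nonempty V with hVe | hVne
  · have : ((univ : Finset V).image orb).filter (fun O => d ∣ O.card) = ∅ := by
      rw [Finset.univ_eq_empty, Finset.image_empty, Finset.filter_empty]
    rw [hN_def, this]
    simp
  set v : ℕ := Fintype.card V with hv_def
  have hv : 0 < v := Fintype.card_pos
  -- the orbit count: Σ_x [d ∣ L x]·(n / L x) = n · N
  have hcount : ∑ x, (if d ∣ L x then n / L x else 0) = n * N := by
    rw [← Finset.sum_fiberwise_of_maps_to (s := (univ : Finset V)) (t := (univ : Finset V).image orb) (g := orb)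
      (fun x hx => Finset.mem_image_of_mem orb hx)]
    have hinner : ∀ O ∈ (univ : Finset V).image orb,
        ∑ x ∈ univ.filter (fun x => orb x = O), (if d ∣ L x then n / L x else 0) =
          if d ∣ O.card then n else 0 := by
      intro O hO
      obtain ⟨x₀, -, rfl⟩ := Finset.mem_image.mp hO
      have hfil : univ.filter (fun x => orb x = orb x₀) = orb x₀ := by
        ext y
        simp only [Finset.mem_filter, Finset.mem_univ, true_and]
        exact ⟨fun h => h ▸ horb_self y, fun h => horb_mem x₀ y h⟩
      rw [hfil]
      have hLy : ∀ y ∈ orb x₀, L y = L x₀ := fun y hy => by rw [← hcard, ← hcard, horb_mem x₀ y hy]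
      rw [Finset.sum_congr rfl (fun y hy => by rw [hLy y hy]), Finset.sum_const, hcard, smul_eq_mul]
      split_ifs with h
      · exact Nat.mul_div_cancel' (hLdvd x₀)
      · simp
    rw [Finset.sum_congr rfl hinner, ← Finset.sum_filter, Finset.sum_const, smul_eq_mul, hN_def, mul_comm]
  -- complex matrices
  set Sc : Matrix V V ℂ := Matrix.of fun x y => ((S x y : ℤ) : ℂ) with hSc_def
  set Pm : Matrix V V ℂ := Matrix.of fun x y => if τ x = y then (1 : ℂ) else 0 with hPm_def
  set Jc : Matrix V V ℂ := Matrix.of fun (_ : V) (_ : V) => (1 : ℂ) with hJc_def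
  have hPpow : ∀ (k : ℕ) x y, (Pm ^ k) x y = if (τ ^ k) x = y then (1 : ℂ) else 0 := by
    have hmulP : ∀ (X : Matrix V V ℂ) x y, (X * Pm) x y = X x (τ.symm y) := by
      intro X x y
      rw [Matrix.mul_apply]
      simp only [hPm_def, Matrix.of_apply, mul_ite, mul_one, mul_zero]
      have e : ∀ z, (τ z = y) ↔ (z = τ.symm y) := fun z => Equiv.apply_eq_iff_eq_symm_apply τ
      simp_rw [e]
      rw [Finset.sum_ite_eq']; simp
    intro k
    induction k with
    | zero => intro x y; simp [Matrix.one_apply]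
    | succ k ih =>
      intro x y
      rw [pow_succ, hmulP, ih, pow_succ', Equiv.Perm.mul_apply]
      have e : ((τ ^ k) x = τ.symm y) ↔ (τ ((τ ^ k) x) = y) := by
        constructor
        · intro h; rw [h, Equiv.apply_symm_apply]
        · intro h; rw [← h, Equiv.symm_apply_apply]
      simp only [e]
  have hPkmul : ∀ (k : ℕ) (X : Matrix V V ℂ) x y, (Pm ^ k * X) x y = X ((τ ^ k) x) y := by
    intro k X x y
    rw [Matrix.mul_apply]
    simp only [hPpow, ite_mul, one_mul, zero_mul]
    rw [Finset.sum_ite_eq]; simp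
  have hPn : Pm ^ n = 1 := by
    ext x y
    rw [hPpow, hτ, Equiv.Perm.one_apply, Matrix.one_apply]
  have hPS : Pm * Sc = Sc * Pm := by
    ext x y
    rw [← pow_one Pm, hPkmul, Matrix.mul_apply]
    simp only [hPpow, pow_one, mul_ite, mul_one, mul_zero]
    have e : ∀ z, (τ z = y) ↔ (z = τ.symm y) := fun z => Equiv.apply_eq_iff_eq_symm_apply τ
    simp_rw [e]
    rw [Finset.sum_ite_eq']
    simp only [Finset.mem_univ, if_true, hSc_def, Matrix.of_apply]
    have := hSτ x (τ.symm y)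
    rw [Equiv.apply_symm_apply] at this
    rw [this]
  have hPJ : ∀ k, Pm ^ k * Jc = Jc := by
    intro k
    ext x y
    rw [hPkmul]
    simp only [hJc_def, Matrix.of_apply]
  have htrP : ∀ k, (Pm ^ k).trace = ((univ.filter fun x => (τ ^ k) x = x).card : ℂ) := by
    intro k
    simp only [Matrix.trace, Matrix.diag, hPpow]
    rw [Finset.sum_boole]
  have htrJ : Jc.trace = (v : ℂ) := by
    simp [Matrix.trace, Matrix.diag, hJc_def, hv_def]
  have hSS2 : Sc * Sc = (v : ℂ) • (1 : Matrix V V ℂ) - Jc := by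
    ext x y
    rw [Matrix.mul_apply, Matrix.sub_apply, Matrix.smul_apply, Matrix.one_apply]
    simp only [hSc_def, hJc_def, Matrix.of_apply, smul_eq_mul, mul_ite, mul_one, mul_zero]
    have h' : ((∑ z, S x z * S z y : ℤ) : ℂ) = (((v : ℤ) * (if x = y then 1 else 0) - 1 : ℤ) : ℂ) := by
      rw [hSS x y]
    push_cast at h'
    rw [h']
    split_ifs <;> simp
  have hSJ : Sc * Jc = 0 := by
    ext x y
    rw [Matrix.mul_apply]
    simp only [hSc_def, hJc_def, Matrix.of_apply, mul_one, Matrix.zero_apply]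
    exact_mod_cast hS1 x
  have hJS : Jc * Sc = 0 := by
    ext x y
    rw [Matrix.mul_apply]
    simp only [hSc_def, hJc_def, Matrix.of_apply, one_mul, Matrix.zero_apply]
    rw [Finset.sum_congr rfl fun z _ => by rw [hSs y z]]
    exact_mod_cast hS1 y
  have hS3 : Sc * Sc * Sc = (v : ℂ) • Sc := by
    rw [hSS2, Matrix.sub_mul, Matrix.smul_mul, Matrix.one_mul, hJS, sub_zero]
  have htrPS : ∀ k, (Pm ^ k * Sc).trace = 0 := by
    intro k
    simp only [Matrix.trace, Matrix.diag]
    rw [Finset.sum_congr rfl fun x _ => hPkmul k Sc x x]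
    simp only [hSc_def, Matrix.of_apply]
    rw [Finset.sum_congr rfl fun x _ => by rw [hSs x ((τ ^ k) x)]]
    exact_mod_cast htw k
  have htrPS2 : ∀ k, (Pm ^ k * (Sc * Sc)).trace =
      (v : ℂ) * ((univ.filter fun x => (τ ^ k) x = x).card : ℂ) - v := by
    intro k
    rw [hSS2, Matrix.mul_sub, Matrix.mul_smul, Matrix.mul_one, hPJ, Matrix.trace_sub, Matrix.trace_smul, htrP,
      htrJ, smul_eq_mul]
  -- the eigenprojector of S for √v
  set c : ℂ := ((Real.sqrt v : ℝ) : ℂ) with hc_def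
  have hcc : c * c = (v : ℂ) := by
    rw [hc_def, ← Complex.ofReal_mul, Real.mul_self_sqrt (Nat.cast_nonneg _)]
    simp
  have hv0 : (v : ℂ) ≠ 0 := by exact_mod_cast hv.ne'
  have h2v : (2 * (v : ℂ)) ≠ 0 := mul_ne_zero two_ne_zero hv0
  have hn0 : (n : ℂ) ≠ 0 := by exact_mod_cast hn.ne'
  set πp : Matrix V V ℂ := (2 * (v : ℂ))⁻¹ • (Sc * Sc + c • Sc) with hπ_def
  have hY : (Sc * Sc + c • Sc) * (Sc * Sc + c • Sc) = (2 * (v : ℂ)) • (Sc * Sc + c • Sc) := by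
    have e1 : Sc * Sc * (Sc * Sc) = (v : ℂ) • (Sc * Sc) := by rw [← Matrix.mul_assoc, hS3, Matrix.smul_mul]
    have e2 : Sc * (Sc * Sc) = (v : ℂ) • Sc := by rw [← Matrix.mul_assoc, hS3]
    rw [Matrix.add_mul, Matrix.mul_add, Matrix.mul_add, Matrix.smul_mul, Matrix.mul_smul, Matrix.smul_mul,
      Matrix.mul_smul, smul_smul, hcc, e1, hS3, e2]
    module
  have hππ : πp * πp = πp := by
    rw [hπ_def, Matrix.smul_mul, Matrix.mul_smul, hY, smul_smul, smul_smul, mul_assoc, inv_mul_cancel₀ h2v,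
      mul_one]
  -- a primitive d-th root of unity and the eigenprojector of P
  obtain ⟨w, hw⟩ : ∃ w : ℂ, IsPrimitiveRoot w d := ⟨_, Complex.isPrimitiveRoot_exp d (by omega)⟩
  have hwn : w ^ n = 1 := (hw.pow_eq_one_iff_dvd n).mpr hdn
  have hw1 : w ≠ 1 := hw.ne_one hd
  have hw0 : w ≠ 0 := hw.ne_zero (by omega)
  set q : Matrix V V ℂ := (n : ℂ)⁻¹ • ∑ k ∈ range n, w ^ k • Pm ^ k with hq_def
  have hshift : ∑ k ∈ range n, w ^ (k + 1) • Pm ^ (k + 1) = ∑ k ∈ range n, w ^ k • Pm ^ k := by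
    have h := Finset.sum_range_succ' (fun k => w ^ k • Pm ^ k) n
    have h' := Finset.sum_range_succ (fun k => w ^ k • Pm ^ k) n
    simp only [pow_zero, one_smul] at h
    rw [hwn, hPn, one_smul] at h'
    exact add_right_cancel (h.symm.trans h')
  have hqP : q * Pm = w⁻¹ • q := by
    rw [hq_def, Matrix.smul_mul, Finset.sum_mul, smul_comm]
    congr 1
    have e : ∀ k ∈ range n, (w ^ k • Pm ^ k) * Pm = w⁻¹ • (w ^ (k + 1) • Pm ^ (k + 1)) := by
      intro k _
      rw [smul_mul_assoc, ← pow_succ, smul_smul, pow_succ' w k, ← mul_assoc, inv_mul_cancel₀ hw0, one_mul]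
    rw [Finset.sum_congr rfl e, ← Finset.smul_sum, hshift]
  have hqPk : ∀ k : ℕ, q * Pm ^ k = (w⁻¹) ^ k • q := by
    intro k
    induction k with
    | zero => simp
    | succ k ih => rw [pow_succ, ← Matrix.mul_assoc, ih, Matrix.smul_mul, hqP, smul_smul, pow_succ]
  have hqq : q * q = q := by
    nth_rw 2 [hq_def]
    rw [Matrix.mul_smul, Matrix.mul_sum]
    have e : ∀ k ∈ range n, q * (w ^ k • Pm ^ k) = q := by
      intro k _
      rw [Matrix.mul_smul, hqPk, smul_smul, ← mul_pow, mul_inv_cancel₀ hw0, one_pow, one_smul]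
    rw [Finset.sum_congr rfl e, Finset.sum_const, Finset.card_range, ← Nat.cast_smul_eq_nsmul ℂ, smul_smul,
      inv_mul_cancel₀ hn0, one_smul]
  -- q commutes with πp
  have hcomm : Commute Pm Sc := hPS
  have hqπ : Commute q πp := by
    rw [hq_def, hπ_def]
    refine Commute.smul_left (Commute.smul_right ?_ _) _
    refine Commute.sum_left _ _ _ fun k _ => Commute.smul_left ?_ _
    have hk : Commute (Pm ^ k) Sc := hcomm.pow_left k
    exact (hk.mul_right hk).add_right (hk.smul_right c)
  -- the idempotent E = q πp and its trace
  set E : Matrix V V ℂ := q * πp with hE_def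
  have hEE : E * E = E := by
    calc q * πp * (q * πp) = q * (πp * q) * πp := by simp only [Matrix.mul_assoc]
      _ = q * (q * πp) * πp := by rw [hqπ.eq]
      _ = (q * q) * (πp * πp) := by simp only [Matrix.mul_assoc]
      _ = q * πp := by rw [hqq, hππ]
  obtain ⟨r, hr⟩ := trace_natCast_of_idempotent E hEE
  have htrE : E.trace = (2 * (n : ℂ))⁻¹ *
      ∑ k ∈ range n, w ^ k * (((univ.filter fun x => (τ ^ k) x = x).card : ℂ) - 1) := by
    have hE' : E = ((n : ℂ)⁻¹ * (2 * (v : ℂ))⁻¹) •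
        ∑ k ∈ range n, w ^ k • (Pm ^ k * (Sc * Sc) + c • (Pm ^ k * Sc)) := by
      rw [hE_def, hq_def, hπ_def, Matrix.smul_mul, Matrix.mul_smul, smul_smul, Finset.sum_mul]
      congr 1
      refine Finset.sum_congr rfl fun k _ => ?_
      rw [Matrix.smul_mul, Matrix.mul_add, Matrix.mul_smul]
    rw [hE', Matrix.trace_smul, Matrix.trace_sum]
    simp only [Matrix.trace_smul, Matrix.trace_add, htrPS2, htrPS, smul_eq_mul, mul_zero, add_zero]
    rw [Finset.mul_sum, Finset.mul_sum]
    refine Finset.sum_congr rfl fun k _ => ?_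
    field_simp
  have hgeom0 : ∑ k ∈ range n, w ^ k = 0 := by
    rw [geom_sum_of_pow_eq_one hwn, if_neg hw1]
  have hcomb : ∑ k ∈ range n, w ^ k * (((univ.filter fun x => (τ ^ k) x = x).card : ℂ)) =
      ((∑ x, (if d ∣ L x then n / L x else 0) : ℕ) : ℂ) := by
    have e : ∀ k, (((univ.filter fun x => (τ ^ k) x = x).card : ℂ)) = ∑ x, if (τ ^ k) x = x then (1 : ℂ) else 0 :=
      fun k => (Finset.sum_boole _ _).symm
    simp_rw [e, Finset.mul_sum, mul_ite, mul_one, mul_zero]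
    rw [Finset.sum_comm, Nat.cast_sum]
    refine Finset.sum_congr rfl fun x _ => ?_
    rw [Nat.cast_ite, Nat.cast_zero]
    simp only [hfix_iff]
    rw [sum_indicator_dvd_pow (hLpos x) (hLdvd x) hwn]
    exact if_congr (hw.pow_eq_one_iff_dvd (L x)) rfl rfl
  -- conclusion
  have hsplit : ∑ k ∈ range n, w ^ k * (((univ.filter fun x => (τ ^ k) x = x).card : ℂ) - 1) =
      ((n * N : ℕ) : ℂ) := by
    simp_rw [mul_sub, mul_one]
    rw [Finset.sum_sub_distrib, hcomb, hgeom0, sub_zero, hcount]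
  rw [hsplit] at htrE
  rw [htrE] at hr
  have h2 : ((n * N : ℕ) : ℂ) = 2 * n * r := by
    field_simp at hr
    linear_combination hr
  push_cast at h2
  have h3 : n * N = n * (2 * r) := by
    have : ((n * N : ℕ) : ℂ) = ((n * (2 * r) : ℕ) : ℂ) := by push_cast; rw [h2]; ring
    exact_mod_cast this
  have h4 : N = 2 * r := Nat.eq_of_mul_eq_mul_left hn h3
  exact ⟨r, by omega⟩

end main

end Summit.Ventures.DiscreteObjects.Hadamard
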